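import Literature.MathematicalPhysics.QuantumFieldTheory.Balaban1983to89.B9Ineq343GpAtLetters
import Literature.MathematicalPhysics.QuantumFieldTheory.Balaban1983to89.B9Ineq346SecondOrderCaccioppoliTorus

/-!
# `Balaban1983to89.B9Ineq346SecondOrderGpAtLetters` — [B9] (3.46) AT U = 1 FOR G′(1), THE THREE SECOND-ORDER MEMBERS
# `‖h∇_UG′∇*_Uλ‖, ‖h∇_U∇_UG′λ‖, ‖hG′∇*_U∇*_Uλ‖` AT NODE 00's OPERATOR LAYER OF LETTERS: the member-leaves n = 3, 4, 5 of the (3.46)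
# leaf of row 11 (`hGp`) are THEOREMS at `ops := Node00.opsYOfLetters N θ M⋆ 𝔏 𝔈`, for EVERY letter record `𝔏` — the torus theorems of
# `B9Ineq346SecondOrderFlatMultiLevelTorus` ∕ `…CaccioppoliTorus` READ through def-Y's reading; ROW 11 ⇐ (3.44) + (3.45) ONLY

T. Bałaban, *Propagators for lattice gauge theories in a background field*, Commun. Math. Phys. **99** (1985) 389–434
[`Balaban1985BackgroundPropagators`, "B9"]; [4] = T. Bałaban, *Propagators and renormalization transformations for lattice
gauge theories. II*, Commun. Math. Phys. **96** (1984) 223–250 [`Balaban1984PropagatorsII`].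

statement-level skeleton of published theorems with citation tags; proofs where landed; nothing here is a claim about the
Yang–Mills mass gap

THE PRINTED LOCI (verbatim).  (3.46), p. 398: *"… ‖h∇_UG′(U)∇\*_Uλ‖, ‖h∇_U∇_UG′(U)λ‖, ‖hG′(U)∇\*_U∇\*_Uλ‖ ≦ B₀[…, 1, 1, 1]|h|
e^{−δ₀d(y,y′)}‖λ‖ for supp h ⊂ Δ̃(y), y ∈ Λ_j, supp λ ⊂ Δ(y′)"*; Cor. 3.5, p. 407: *"For operators with the external gauge field
configuration U = 1, these theorems are proved in [4]"* — [4] prints at U = 1 only the sup ∕ Hölder members (2.67): the three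
second-order `L²` members have NO sup majorant there (cell GAP G-B9-03a).  They are PROVED on the genuine k-level torus by this seat
(`B9Ineq346SecondOrderFlatMultiLevelTorus.ineq346_ddGp∕Gpdd_flat_multiLevelTorus`, `B9Ineq346SecondOrderCaccioppoliTorus.ineq346_dGpd_flat_multiLevelTorus`:
local energy estimates at the block scale fed by lit-balaban-p21's first-order members).

THE POINT.  After dag-n06-h g2's FILES 9–10 row 11 of the N06 knit at def-Y's instance was `hGp_opsYOfLetters_of_leaves5` with FIVE displayed leaves:
`AtOneL2nOn … 3∕4∕5`, `AtOneE4On`, `AtOneH2On`.  THIS FILE reads the three torus theorems through def-Y's `kernelFamilyS.l2` (members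
n = 3, 4, 5: `∂_μO∂*_ν`, `∂_μ∂_νO`, `O∂*_μ∂*_ν`; prefactor `η⁰`, `pref6 · n = 1`) exactly as FILE 9 read members 0, 1, 2:

* §1 `l2_member_bound0` (m = 0 form of FILE 9's one torus lemma: squared block bound `C·e^{−δd}` ⇒
  `‖h·Tλ‖ ≤ √C·|h|·e^{−(δ∕2)d}·‖λ‖`), ★ `ineq346_Gp_kIdx_second` — (3.46)₃,₄,₅ AT U = 1 for T8's `KTIdx.G` at every k-level index above a
  threshold, print's units, one-block cut-offs ∕ supports.
* §2 letter ∕ member level: `l2S3∕4∕5_one_le`, ★ `Gp_l2_one_inl_inl_le3∕4∕5` (`pref6 · n = 1` by `rfl`).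
* §3 ★★ `atOneL2nOn_Gp_letters_3 ∕ _4 ∕ _5` — THE THREE MEMBER-LEAVES HOLD at the layer of letters, every `𝔏 𝔈`; ★★
  `residualGpAtOne_letters_of_leaves2` — ROW 11 at the layer ⇐ (3.44) + (3.45) ONLY (the input-Hölder members of G′(1); discrete
  Schauder estimates, not in the tree); record faces ★★ `atOneL2nOn_Gp_opsYOfLetters_3∕4∕5`, ★★ `hGp_opsYOfLetters_of_leaves2 N θ M⋆ 𝔏 𝔈 hE4 hH2`.

HONEST SCOPE.  Three MEMBER-leaves of row 11 are discharged at the layer of letters; the analytic content is this seat's torus analysis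
(Core ∕ Cutoff ∕ FlatMultiLevelTorus ∕ CaccioppoliTorus files) on lit-balaban-p21's lineage.  The residual of row 11 after this file is
(3.44) + (3.45) for G′(1) on site arguments (sup and Hölder norm of `∇G′∇*λ` against the Hölder norm of `λ`).  The letters are NOT
constructed (def-Y's successor `lettersYOfRecord`); nothing of [B9] is asserted beyond what is proved; count-neutral; N06 NOT discharged;
one finite lattice programme — nothing continuum, nothing about the mass gap.  Cell `pub-ymgap` (HUMAN RULING D-0062), Track A node N06
[B9], N06-ASSIGNMENT v1 row 11 (bundle F3) at def-Y's instance, seat `pub-ymgap-dag-n06-h` (g3), 2026-08-27.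
-/

noncomputable section

namespace Literature.MathematicalPhysics.QuantumFieldTheory.Balaban1983to89.B9Ineq346SecondOrderGpAtLetters

open B4Reflection242 (boxDom)
open B6MultiLevelBoxOperator (N0 aPrinted)
open B6MultiLevelTorusOperator (TDomains gmlT)
open B6Prop22DerivMultiLevelTorus (dT)
open B6Geom246MultiLevelBox (bset blkOf)
open B6Geom246MultiLevelTorus (geomT)
open B6Ineq2142KLevelV1 (β beta_level)
open B6KLevelCensusIndexV1 (KIdx kGeo)
open B6Prop22KLevelTorusCensus (KTIdx)
open B6Prop26Census2136KLevelV1 (l2Of)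
open B9Thm314GpFlatMultiLevelTorus (consts_260_261)
open B9Ineq346SecondOrderFlatMultiLevelTorus (ineq346_ddGp_flat_multiLevelTorus ineq346_Gpdd_flat_multiLevelTorus)
open B9Ineq346SecondOrderCaccioppoliTorus (ineq346_dGpd_flat_multiLevelTorus)
open B9Ineq346GpAtLetters (sum_sq_cut_le Gp_l2_one_inl_inl len_geo9Y_eq l2rhs_nonneg)
open B9Cor35ComparisonsGpCAtLetters (cdS_one_liftY cdsS_one_liftY)
open B9Cor35ComparisonsGAAtLetters (l2OfY_liftY_le)
open B9Cor35ComparisonsEHAtLetters (Gp_l2_inl_inr)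
open B9Ineq347GpAtLetters (etaS_toKIdx)
open B9Ineq343GpAtLetters (residualGpAtOne_letters_of_leaves5)
open B9FromB6 (ResidualGpAtOne pref6_nonneg)
open B9ResidualEntriesAtOne (AtOneL2nOn AtOneE4On AtOneH2On)
open B9PinMembersKLevelV1 (MemberY geo9Y bg9Y)
open B7Prop2SpecialUnitary (specialUnitaryUnits)
open Node00
open scoped Matrix

variable {d ℓ : ℕ} {hd : 1 ≤ d + 1} {hL : Odd (ℓ + 1) ∧ 1 < ℓ + 1} {b₀ b₁ : ℝ} {Mstar : ℕ}
variable {𝔸 : Type} [NormedRing 𝔸] [NormedAlgebra ℂ 𝔸] [CompleteSpace 𝔸]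

/-! ## §1 The torus lemma at weight exponent `0` and the three members at every k-level index -/

section KLevel

/-- a real supremum times a nonnegative scalar is bounded when each member is. [cite: Balaban1985BackgroundPropagators, (3.46) p.398, bookkeeping] -/
theorem mul_iSup_le' {ι : Type} {u : ι → ℝ} {η R : ℝ} (hη : 0 ≤ η) (hR : 0 ≤ R) (h : ∀ k, η * u k ≤ R) :
    η * (⨆ k, u k) ≤ R := by
  rcases hη.eq_or_lt with hη0 | hηpos
  · rw [← hη0, zero_mul]; exact hR
  · have hk : ∀ k, u k ≤ R / η := fun k => (le_div_iff₀ hηpos).2 (by rw [mul_comm]; exact h k)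
    calc η * (⨆ k, u k) ≤ η * (R / η) := mul_le_mul_of_nonneg_left (Real.iSup_le hk (div_nonneg hR hη)) hη
      _ = R := mul_div_cancel₀ R hηpos.ne'

/-- a supremum of quantities each `≤ R` (`R ≥ 0`) is `≤ R`. [cite: Balaban1985BackgroundPropagators, (3.46) p.398, bookkeeping] -/
theorem iSup_le' {ι : Type} {u : ι → ℝ} {R : ℝ} (hR : 0 ≤ R) (h : ∀ k, u k ≤ R) : (⨆ k, u k) ≤ R := Real.iSup_le h hR

/-- **THE TORUS LEMMA AT WEIGHT EXPONENT `0`**: a squared block bound `Σ_{x∈B(s)}((Tλ)(x))² ≤ C·e^{−δd(s,s′)}·Σλ²` for `λ` in `B(s′)`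
and a cut-off `h` supported in `B(s)` give `‖h·Tλ‖ ≤ √C·|h|·e^{−(δ∕2)d(s,s′)}·‖λ‖`.
[cite: Balaban1985BackgroundPropagators, (3.46) p.398 (prefactor `1`), bookkeeping] -/
theorem l2_member_bound0 {Mh k R : ℕ} {P : Fin (d + 1) → ℕ} (D : TDomains d ℓ Mh k P R)
    {T : Matrix ↥(boxDom (N0 ℓ Mh k P)) ↥(boxDom (N0 ℓ Mh k P)) ℝ} {C δ : ℝ} (hC : 0 ≤ C)
    (s s' : ↥(bset D.toDomains)) (hh f : ↥(boxDom (N0 ℓ Mh k P)) → ℝ) (hhh : ∀ x, hh x ≠ 0 → blkOf D.toDomains x = s)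
    (h346 : ∑ x ∈ Finset.univ.filter (fun x => blkOf D.toDomains x = s), ((T *ᵥ f) x) ^ 2
      ≤ C * Real.exp (-(δ * (geomT D).dist s s')) * ∑ z, f z ^ 2) :
    l2Of hh (T *ᵥ f) ≤ Real.sqrt C * (⨆ x, |hh x|) * Real.exp (-(δ / 2 * (geomT D).dist s s')) * Real.sqrt (∑ z, f z ^ 2) := by
  have hS : 0 ≤ ⨆ x, |hh x| := Real.iSup_nonneg fun _ => abs_nonneg _
  have hQ : 0 ≤ ∑ z, f z ^ 2 := Finset.sum_nonneg fun _ _ => sq_nonneg _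
  have h2 : ∑ x, (hh x * (T *ᵥ f) x) ^ 2 ≤ (⨆ x, |hh x|) ^ 2 * (C * Real.exp (-(δ * (geomT D).dist s s')) * ∑ z, f z ^ 2) :=
    (sum_sq_cut_le D s hh (T *ᵥ f) hhh).trans (mul_le_mul_of_nonneg_left h346 (sq_nonneg _))
  have hexp : Real.exp (-(δ * (geomT D).dist s s')) = Real.exp (-(δ / 2 * (geomT D).dist s s')) ^ 2 := by
    rw [← Real.exp_nat_mul]; congr 1; ring
  unfold l2Of
  refine (Real.sqrt_le_left (by positivity)).2 (h2.trans_eq ?_)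
  rw [hexp]
  simp only [mul_pow, Real.sq_sqrt hC, Real.sq_sqrt hQ]
  ring

/-- ★ **(3.46), MEMBERS `‖h∂_μG′∂_νᵀλ‖, ‖h∂_μ∂_νG′λ‖, ‖hG′∂_μᵀ∂_νᵀλ‖`, AT `U = 1` FOR `G′ = Δ′_a⁻¹` (T8's `KTIdx.G`) AT EVERY k-LEVEL V1 INDEX
ABOVE A THRESHOLD — PRINT'S UNITS (prefactor `η⁰ = 1`), ONE-BLOCK CUT-OFF `h` AND SUPPORT.**  There are `M₁, C, δ₀ > 0` such that for every index
with `M = L·M_h ≥ M₁`, all blocks `s, s′`, every cut-off `h` supported in `B(s)`, every `λ` supported in `B(s′)` and all `μ, ν`: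
`‖h∂_μG′∂_νᵀλ‖, ‖h∂_μ∂_νG′λ‖, ‖hG′∂_μᵀ∂_νᵀλ‖ ≤ C|h|e^{−δ₀d(s,s′)}‖λ‖` (flat `L²` norms `l2Of`).  This seat's three torus theorems at the
printed weights + §1. [cite: Balaban1985BackgroundPropagators, Thm 3.1 (3.46) p.398 + Cor. 3.5 p.407; Balaban1984PropagatorsII, Prop. 2.2 (2.67), Lemma 2.1 p.234] -/
theorem ineq346_Gp_kIdx_second : ∃ M₁ C δ₀ : ℝ, 0 < M₁ ∧ 0 < C ∧ 0 < δ₀ ∧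
    ∀ i : KIdx d ℓ hd hL b₀ b₁, M₁ ≤ (kGeo i).M → ∀ (s s' : ↥(bset i.D.toDomains)) (hh f : SiteY i → ℝ),
      (∀ x, hh x ≠ 0 → blkOf i.D.toDomains x = s) → (∀ x, f x ≠ 0 → blkOf i.D.toDomains x = s') → ∀ μ ν : Fin (d + 1),
      l2Of hh ((dT (toKT i).NB μ * (toKT i).G * (dT (toKT i).NB ν)ᵀ) *ᵥ f)
          ≤ C * (⨆ x, |hh x|) * Real.exp (-(δ₀ * (geomT i.D).dist s s')) * Real.sqrt (∑ z, f z ^ 2) ∧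
      l2Of hh ((dT (toKT i).NB μ * dT (toKT i).NB ν * (toKT i).G) *ᵥ f)
          ≤ C * (⨆ x, |hh x|) * Real.exp (-(δ₀ * (geomT i.D).dist s s')) * Real.sqrt (∑ z, f z ^ 2) ∧
      l2Of hh (((toKT i).G * (dT (toKT i).NB μ)ᵀ * (dT (toKT i).NB ν)ᵀ) *ᵥ f)
          ≤ C * (⨆ x, |hh x|) * Real.exp (-(δ₀ * (geomT i.D).dist s s')) * Real.sqrt (∑ z, f z ^ 2) := by
  by_cases hℓ : 1 ≤ ℓ
  swap
  · exact ⟨1, 1, 1, one_pos, one_pos, one_pos, fun i => absurd (le_trans (by norm_num) i.hℓ) hℓ⟩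
  have hL0 : (0 : ℝ) < (ℓ : ℝ) + 1 := by positivity
  have hL2 : (1 : ℝ) < ((ℓ : ℝ) + 1) ^ 2 := by
    have h1 : (1 : ℝ) ≤ ℓ := by exact_mod_cast hℓ
    nlinarith
  have hamin : 0 < 1 - ((((ℓ : ℝ) + 1)) ^ 2)⁻¹ := by
    rw [sub_pos]
    exact inv_lt_one_of_one_lt₀ hL2
  obtain ⟨hwin, hrec⟩ := B6Prop22KLevelCensus.KIdx.aPrinted_windows hℓ
  obtain ⟨δa, Ca, Ma, Na, hδa, hCa, hMa, -, Ha⟩ :=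
    ineq346_dGpd_flat_multiLevelTorus d ℓ hℓ (1 - ((((ℓ : ℝ) + 1)) ^ 2)⁻¹) 1 1 1 hamin one_pos
  obtain ⟨δb, Cb, Mb, Nb, hδb, hCb, hMb, -, Hb⟩ :=
    ineq346_ddGp_flat_multiLevelTorus d ℓ hℓ (1 - ((((ℓ : ℝ) + 1)) ^ 2)⁻¹) 1 1 1 hamin one_pos
  obtain ⟨δc, Cc, Mc, Nc', hδc, hCc, hMc, -, Hc⟩ :=
    ineq346_Gpdd_flat_multiLevelTorus d ℓ hℓ (1 - ((((ℓ : ℝ) + 1)) ^ 2)⁻¹) 1 1 1 hamin one_pos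
  have hδ : 0 < min δa (min δb δc) := lt_min hδa (lt_min hδb hδc)
  refine ⟨max (max Ma (max Mb Mc)) (((max Na (max Nb Nc') : ℕ) : ℝ) + 1), Real.sqrt (max Ca (max Cb Cc)), min δa (min δb δc) / 2,
    lt_max_of_lt_left (lt_max_of_lt_left hMa), Real.sqrt_pos.2 (lt_max_of_lt_left hCa), by positivity, ?_⟩
  intro i hM s s' hh f hhh hf μ ν
  have hLcast : (((ℓ + 1 : ℕ) : ℝ)) = (ℓ : ℝ) + 1 := by push_cast; ring
  have hM' : max (max Ma (max Mb Mc)) (((max Na (max Nb Nc') : ℕ) : ℝ) + 1) ≤ ((ℓ : ℝ) + 1) * i.Mh := by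
    have hMdef : (kGeo i).M = (((ℓ + 1 : ℕ) : ℝ)) * (i.Mh : ℝ) := rfl
    rw [hMdef, hLcast] at hM
    exact hM
  have hMh3 : 3 ≤ i.Mh := le_trans (by norm_num) i.hM8
  have hMa' : Ma ≤ ((ℓ : ℝ) + 1) * i.Mh := ((le_max_left _ _).trans (le_max_left _ _)).trans hM'
  have hMb' : Mb ≤ ((ℓ : ℝ) + 1) * i.Mh := (((le_max_left _ _).trans (le_max_right _ _)).trans (le_max_left _ _)).trans hM'
  have hMc' : Mc ≤ ((ℓ : ℝ) + 1) * i.Mh := (((le_max_right _ _).trans (le_max_right _ _)).trans (le_max_left _ _)).trans hM'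
  have hR1 : 1 ≤ i.R := le_trans (by omega) (toKT i).hR
  have hRN : ∀ N : ℕ, N ≤ max Na (max Nb Nc') → N + 1 ≤ i.R * ((ℓ + 1) * i.Mh) := by
    intro N hN
    have h1 : (((max Na (max Nb Nc') : ℕ) : ℝ) + 1) ≤ ((ℓ : ℝ) + 1) * i.Mh := (le_max_right _ _).trans hM'
    have h2 : max Na (max Nb Nc') + 1 ≤ (ℓ + 1) * i.Mh := by exact_mod_cast h1
    calc N + 1 ≤ 1 * ((ℓ + 1) * i.Mh) := by rw [one_mul]; omega
      _ ≤ i.R * ((ℓ + 1) * i.Mh) := Nat.mul_le_mul_right _ hR1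
  have hRNa : Na + 1 ≤ i.R * ((ℓ + 1) * i.Mh) := hRN Na (le_max_left _ _)
  have hRNb : Nb + 1 ≤ i.R * ((ℓ + 1) * i.Mh) := hRN Nb ((le_max_left _ _).trans (le_max_right _ _))
  have hRNc : Nc' + 1 ≤ i.R * ((ℓ + 1) * i.Mh) := hRN Nc' ((le_max_right _ _).trans (le_max_right _ _))
  have hf0 : ∀ z, blkOf i.D.toDomains z ≠ s' → f z = 0 := fun z hz => by
    by_contra h
    exact hz (hf z h)
  have hdd : 0 ≤ (geomT i.D).dist s s' := by exact Nat.cast_nonneg _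
  have hpack : ∀ {δ' C' : ℝ} {T : Matrix ↥(boxDom (N0 ℓ i.Mh i.k i.P')) ↥(boxDom (N0 ℓ i.Mh i.k i.P')) ℝ},
      min δa (min δb δc) ≤ δ' → C' ≤ max Ca (max Cb Cc) →
      ∑ x ∈ Finset.univ.filter (fun x => blkOf i.D.toDomains x = s), ((T *ᵥ f) x) ^ 2
        ≤ C' * Real.exp (-(δ' * (geomT i.D).dist s s')) * ∑ z, f z ^ 2 →
      l2Of hh (T *ᵥ f) ≤ Real.sqrt (max Ca (max Cb Cc)) * (⨆ x, |hh x|)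
        * Real.exp (-(min δa (min δb δc) / 2 * (geomT i.D).dist s s')) * Real.sqrt (∑ z, f z ^ 2) := by
    intro δ' C' T hδ' hC' h
    have hQ : 0 ≤ ∑ z, f z ^ 2 := Finset.sum_nonneg fun _ _ => sq_nonneg _
    have h' : ∑ x ∈ Finset.univ.filter (fun x => blkOf i.D.toDomains x = s), ((T *ᵥ f) x) ^ 2
        ≤ max Ca (max Cb Cc) * Real.exp (-(min δa (min δb δc) * (geomT i.D).dist s s')) * ∑ z, f z ^ 2 := by
      refine h.trans (mul_le_mul_of_nonneg_right (mul_le_mul hC' (Real.exp_le_exp.2 ?_) (Real.exp_pos _).le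
        (hCa.le.trans (le_max_left _ _))) hQ)
      have := mul_le_mul_of_nonneg_right hδ' hdd
      linarith
    exact l2_member_bound0 i.D (hCa.le.trans (le_max_left _ _)) s s' hh f hhh h'
  refine ⟨?_, ?_, ?_⟩
  · exact hpack (min_le_left _ _) (le_max_left _ _)
      (Ha i.k i.Mh i.R hMh3 hMa' (toKT i).hR hRNa i.P' (toKT i).hP (toKT i).hP4 i.D (aPrinted ℓ 1) (fun _ => 1) hwin
        (fun j _ => ⟨le_rfl, le_rfl⟩) hrec μ ν s s' f hf0)
  · exact hpack ((min_le_right _ _).trans (min_le_left _ _)) ((le_max_left _ _).trans (le_max_right _ _))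
      (Hb i.k i.Mh i.R hMh3 hMb' (toKT i).hR hRNb i.P' (toKT i).hP (toKT i).hP4 i.D (aPrinted ℓ 1) (fun _ => 1) hwin
        (fun j _ => ⟨le_rfl, le_rfl⟩) hrec μ ν s s' f hf0)
  · exact hpack ((min_le_right _ _).trans (min_le_right _ _)) ((le_max_right _ _).trans (le_max_right _ _))
      (Hc i.k i.Mh i.R hMh3 hMc' (toKT i).hR hRNc i.P' (toKT i).hP (toKT i).hP4 i.D (aPrinted ℓ 1) (fun _ => 1) hwin
        (fun j _ => ⟨le_rfl, le_rfl⟩) hrec μ ν s s' f hf0)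

end KLevel

/-! ## §2 At a site-sector letter and at a member: the reading's (3.46)₃,₄,₅ at `U = 1` -/

section Letter

variable (i : KIdx d ℓ hd hL b₀ b₁) (O : SiteOpY 𝔸 i)
  (hO : ∀ (f : SiteY i → ℝ) (E : 𝔸), O (fun _ _ => 1) (liftY f E) = liftY ((toKT i).G *ᵥ f) E)
include hO

/-- `‖h·∇_{1,μ}G′(1)∇*_{1,ν}(f ⊗ E)‖ ≤ ‖h·∂_μG′∂_νᵀf‖`. [cite: Balaban1985BackgroundPropagators, (3.46) p.398 + (3.3), (3.8) + Cor. 3.5 p.407] -/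
theorem l2S3_one_le (hh f : SiteY i → ℝ) (E : BallY 𝔸) (μ ν : Fin (d + 1)) :
    l2OfY hh (cdS i (fun _ _ => 1) μ (O (fun _ _ => 1) (cdsS i (fun _ _ => 1) ν (liftY f (E : 𝔸)))))
      ≤ l2Of hh ((dT (toKT i).NB μ * (toKT i).G * (dT (toKT i).NB ν)ᵀ) *ᵥ f) := by
  rw [cdsS_one_liftY, hO, cdS_one_liftY, Matrix.mulVec_mulVec, Matrix.mulVec_mulVec]
  exact l2OfY_liftY_le hh _ E

/-- `‖h·∇_{1,μ}∇_{1,ν}G′(1)(f ⊗ E)‖ ≤ ‖h·∂_μ∂_νG′f‖`. [cite: Balaban1985BackgroundPropagators, (3.46) p.398 + (3.3) + Cor. 3.5 p.407] -/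
theorem l2S4_one_le (hh f : SiteY i → ℝ) (E : BallY 𝔸) (μ ν : Fin (d + 1)) :
    l2OfY hh (cdS i (fun _ _ => 1) μ (cdS i (fun _ _ => 1) ν (O (fun _ _ => 1) (liftY f (E : 𝔸)))))
      ≤ l2Of hh ((dT (toKT i).NB μ * dT (toKT i).NB ν * (toKT i).G) *ᵥ f) := by
  rw [hO, cdS_one_liftY, cdS_one_liftY, Matrix.mulVec_mulVec, Matrix.mulVec_mulVec]
  exact l2OfY_liftY_le hh _ E

/-- `‖h·G′(1)∇*_{1,μ}∇*_{1,ν}(f ⊗ E)‖ ≤ ‖h·G′∂_μᵀ∂_νᵀf‖`. [cite: Balaban1985BackgroundPropagators, (3.46) p.398 + (3.8) + Cor. 3.5 p.407] -/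
theorem l2S5_one_le (hh f : SiteY i → ℝ) (E : BallY 𝔸) (μ ν : Fin (d + 1)) :
    l2OfY hh (O (fun _ _ => 1) (cdsS i (fun _ _ => 1) μ (cdsS i (fun _ _ => 1) ν (liftY f (E : 𝔸)))))
      ≤ l2Of hh (((toKT i).G * (dT (toKT i).NB μ)ᵀ * (dT (toKT i).NB ν)ᵀ) *ᵥ f) := by
  rw [cdsS_one_liftY, cdsS_one_liftY, hO, Matrix.mulVec_mulVec, Matrix.mulVec_mulVec]
  exact l2OfY_liftY_le hh _ E

end Letter

section Member

variable {G : Subgroup 𝔸ˣ} (x : MemberY d ℓ hd hL b₀ b₁ Mstar) (𝔏 : CovLettersY 𝔸 x) (𝔈 : ExpLettersY 𝔸 G x)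

/-- ★ member 3: `(ops x).Gp.l2 3 1 (.inl f) (.inl h) ≤ R` once `‖h·∂_μG′∂_νᵀf‖ ≤ R` for all `μ, ν` (`R ≥ 0`; prefactor `η⁰`).
[cite: Balaban1985BackgroundPropagators, (3.46) p.398 + Cor. 3.5 p.407] -/
theorem Gp_l2_one_inl_inl_le3 (f hh : SiteY x.toKIdx → ℝ) {R : ℝ} (hR : 0 ≤ R)
    (h : ∀ μ ν : Fin (d + 1), l2Of hh ((dT (toKT x.toKIdx).NB μ * (toKT x.toKIdx).G * (dT (toKT x.toKIdx).NB ν)ᵀ) *ᵥ f) ≤ R) :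
    (operatorLayerYOfLetters 𝔸 G x 𝔏 𝔈).Gp.l2 3 (bg9Y 𝔸 G x).one (Sum.inl f) (Sum.inl hh) ≤ R := by
  have hv : ((![2, 1, 1, 0, 0, 0] : Fin 6 → ℕ) 3) = 0 := rfl
  rw [Gp_l2_one_inl_inl, hv, pow_zero]
  refine mul_iSup_le' zero_le_one hR fun E => ?_
  rw [one_mul]
  refine iSup_le' hR fun μ => iSup_le' hR fun ν => ?_
  exact (l2S3_one_le x.toKIdx 𝔏.Gp 𝔏.Gp_one hh f E μ ν).trans (h μ ν)

/-- ★ member 4: `(ops x).Gp.l2 4 1 (.inl f) (.inl h) ≤ R` once `‖h·∂_μ∂_νG′f‖ ≤ R` for all `μ, ν`. [cite: Balaban1985BackgroundPropagators, (3.46) p.398 + Cor. 3.5 p.407] -/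
theorem Gp_l2_one_inl_inl_le4 (f hh : SiteY x.toKIdx → ℝ) {R : ℝ} (hR : 0 ≤ R)
    (h : ∀ μ ν : Fin (d + 1), l2Of hh ((dT (toKT x.toKIdx).NB μ * dT (toKT x.toKIdx).NB ν * (toKT x.toKIdx).G) *ᵥ f) ≤ R) :
    (operatorLayerYOfLetters 𝔸 G x 𝔏 𝔈).Gp.l2 4 (bg9Y 𝔸 G x).one (Sum.inl f) (Sum.inl hh) ≤ R := by
  have hv : ((![2, 1, 1, 0, 0, 0] : Fin 6 → ℕ) 4) = 0 := rfl
  rw [Gp_l2_one_inl_inl, hv, pow_zero]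
  refine mul_iSup_le' zero_le_one hR fun E => ?_
  rw [one_mul]
  refine iSup_le' hR fun μ => iSup_le' hR fun ν => ?_
  exact (l2S4_one_le x.toKIdx 𝔏.Gp 𝔏.Gp_one hh f E μ ν).trans (h μ ν)

/-- ★ member 5: `(ops x).Gp.l2 5 1 (.inl f) (.inl h) ≤ R` once `‖h·G′∂_μᵀ∂_νᵀf‖ ≤ R` for all `μ, ν`. [cite: Balaban1985BackgroundPropagators, (3.46) p.398 + Cor. 3.5 p.407] -/
theorem Gp_l2_one_inl_inl_le5 (f hh : SiteY x.toKIdx → ℝ) {R : ℝ} (hR : 0 ≤ R)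
    (h : ∀ μ ν : Fin (d + 1), l2Of hh (((toKT x.toKIdx).G * (dT (toKT x.toKIdx).NB μ)ᵀ * (dT (toKT x.toKIdx).NB ν)ᵀ) *ᵥ f) ≤ R) :
    (operatorLayerYOfLetters 𝔸 G x 𝔏 𝔈).Gp.l2 5 (bg9Y 𝔸 G x).one (Sum.inl f) (Sum.inl hh) ≤ R := by
  have hv : ((![2, 1, 1, 0, 0, 0] : Fin 6 → ℕ) 5) = 0 := rfl
  rw [Gp_l2_one_inl_inl, hv, pow_zero]
  refine mul_iSup_le' zero_le_one hR fun E => ?_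
  rw [one_mul]
  refine iSup_le' hR fun μ => iSup_le' hR fun ν => ?_
  exact (l2S5_one_le x.toKIdx 𝔏.Gp 𝔏.Gp_one hh f E μ ν).trans (h μ ν)

end Member

/-! ## §3 The three member-leaves at the layer of letters; row 11 from (3.44) + (3.45) only -/

section Layer

variable {G : Subgroup 𝔸ˣ} (𝔏 : ∀ x : MemberY d ℓ hd hL b₀ b₁ Mstar, CovLettersY 𝔸 x)
  (𝔈 : ∀ x : MemberY d ℓ hd hL b₀ b₁ Mstar, ExpLettersY 𝔸 G x)

/-- ★★ **THE (3.46) MEMBER-LEAF `‖h∇_UG′∇*_Uλ‖` OF ROW 11 HOLDS AT NODE 00's LAYER OF LETTERS**, every `𝔏 𝔈`: one threshold, one `B₀`, one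
`δ₀` with `(ops x).Gp.l2 3 1 λ h ≤ B₀·|h|e^{−δ₀d(y,y′)}‖λ‖` for site arguments `λ` supported in `Δ(y′)` and cut-offs `h` in `Δ(y)`.
[cite: Balaban1985BackgroundPropagators, Thm 3.1 (3.46) p.398 + Cor. 3.5 p.407; Balaban1984PropagatorsII, Prop. 2.2 (2.67), Lemma 2.1 p.234] -/
theorem atOneL2nOn_Gp_letters_3 :
    AtOneL2nOn geo9Y (bg9Y 𝔸 G) (fun x => (operatorLayerYOfLetters 𝔸 G x (𝔏 x) (𝔈 x)).Gp) (fun _ lam => ¬ (lam.isRight = true)) 3 := by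
  obtain ⟨M₁, C, δ₀, hM₁, hC, hδ₀, H⟩ := ineq346_Gp_kIdx_second (d := d) (ℓ := ℓ) (hd := hd) (hL := hL) (b₀ := b₀) (b₁ := b₁)
  refine ⟨M₁, C, δ₀, hM₁, hC, hδ₀, fun x hx lam h y y' hP hcut hsupp => ?_⟩
  cases lam with
  | inr J => exact absurd rfl hP
  | inl f =>
    cases h with
    | inr z =>
        rw [Gp_l2_inl_inr]
        exact l2rhs_nonneg x hC.le 3 _ _ y y'
    | inl hh =>
        have hk := fun μ ν => (H x.toKIdx hx (β x.hN x.D x.hk y) (β x.hN x.D x.hk y') hh f hcut hsupp μ ν).1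
        refine Gp_l2_one_inl_inl_le3 x (𝔏 x) (𝔈 x) f hh (l2rhs_nonneg x hC.le 3 _ _ y y') fun μ ν => (hk μ ν).trans (le_of_eq ?_)
        rw [show B9.pref6 ((geo9Y x).len y) 3 = 1 from rfl, mul_one]
        rfl

/-- ★★ **THE (3.46) MEMBER-LEAF `‖h∇_U∇_UG′λ‖` OF ROW 11 HOLDS AT THE LAYER OF LETTERS**, every `𝔏 𝔈`.
[cite: Balaban1985BackgroundPropagators, Thm 3.1 (3.46) p.398 + Cor. 3.5 p.407; Balaban1984PropagatorsII, Prop. 2.2 (2.67), Lemma 2.1 p.234] -/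
theorem atOneL2nOn_Gp_letters_4 :
    AtOneL2nOn geo9Y (bg9Y 𝔸 G) (fun x => (operatorLayerYOfLetters 𝔸 G x (𝔏 x) (𝔈 x)).Gp) (fun _ lam => ¬ (lam.isRight = true)) 4 := by
  obtain ⟨M₁, C, δ₀, hM₁, hC, hδ₀, H⟩ := ineq346_Gp_kIdx_second (d := d) (ℓ := ℓ) (hd := hd) (hL := hL) (b₀ := b₀) (b₁ := b₁)
  refine ⟨M₁, C, δ₀, hM₁, hC, hδ₀, fun x hx lam h y y' hP hcut hsupp => ?_⟩
  cases lam with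
  | inr J => exact absurd rfl hP
  | inl f =>
    cases h with
    | inr z =>
        rw [Gp_l2_inl_inr]
        exact l2rhs_nonneg x hC.le 4 _ _ y y'
    | inl hh =>
        have hk := fun μ ν => (H x.toKIdx hx (β x.hN x.D x.hk y) (β x.hN x.D x.hk y') hh f hcut hsupp μ ν).2.1
        refine Gp_l2_one_inl_inl_le4 x (𝔏 x) (𝔈 x) f hh (l2rhs_nonneg x hC.le 4 _ _ y y') fun μ ν => (hk μ ν).trans (le_of_eq ?_)
        rw [show B9.pref6 ((geo9Y x).len y) 4 = 1 from rfl, mul_one]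
        rfl

/-- ★★ **THE (3.46) MEMBER-LEAF `‖hG′∇*_U∇*_Uλ‖` OF ROW 11 HOLDS AT THE LAYER OF LETTERS**, every `𝔏 𝔈`.
[cite: Balaban1985BackgroundPropagators, Thm 3.1 (3.46) p.398 + Cor. 3.5 p.407; Balaban1984PropagatorsII, Prop. 2.2 (2.67), Lemma 2.1 p.234] -/
theorem atOneL2nOn_Gp_letters_5 :
    AtOneL2nOn geo9Y (bg9Y 𝔸 G) (fun x => (operatorLayerYOfLetters 𝔸 G x (𝔏 x) (𝔈 x)).Gp) (fun _ lam => ¬ (lam.isRight = true)) 5 := by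
  obtain ⟨M₁, C, δ₀, hM₁, hC, hδ₀, H⟩ := ineq346_Gp_kIdx_second (d := d) (ℓ := ℓ) (hd := hd) (hL := hL) (b₀ := b₀) (b₁ := b₁)
  refine ⟨M₁, C, δ₀, hM₁, hC, hδ₀, fun x hx lam h y y' hP hcut hsupp => ?_⟩
  cases lam with
  | inr J => exact absurd rfl hP
  | inl f =>
    cases h with
    | inr z =>
        rw [Gp_l2_inl_inr]
        exact l2rhs_nonneg x hC.le 5 _ _ y y'
    | inl hh =>
        have hk := fun μ ν => (H x.toKIdx hx (β x.hN x.D x.hk y) (β x.hN x.D x.hk y') hh f hcut hsupp μ ν).2.2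
        refine Gp_l2_one_inl_inl_le5 x (𝔏 x) (𝔈 x) f hh (l2rhs_nonneg x hC.le 5 _ _ y y') fun μ ν => (hk μ ν).trans (le_of_eq ?_)
        rw [show B9.pref6 ((geo9Y x).len y) 5 = 1 from rfl, mul_one]
        rfl

/-- ★★ **ROW `hGp` AT THE LAYER OF LETTERS FROM (3.44) + (3.45) ONLY** — the input-Hölder members of G′(1) on site arguments (sup and Hölder
norm of `∇G′∇*λ` against `‖λ‖_ε + |λ|`: discrete Schauder estimates, not in the tree); ALL six (3.46) members, the (3.47) leaf and the (3.43)
leaf (as typed at the record) are PROVED (this seat's FILES 7, 9, 10, 14 with lit-balaban-p21's torus programme).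
[cite: Balaban1985BackgroundPropagators, Cor. 3.5 p.407 + Thm 3.1 (3.43)–(3.47) p.398; Balaban1984PropagatorsII, Prop. 2.2 (2.67), Lemma 2.1 p.234] -/
theorem residualGpAtOne_letters_of_leaves2
    (hE4 : AtOneE4On geo9Y (bg9Y 𝔸 G) (fun x => (operatorLayerYOfLetters 𝔸 G x (𝔏 x) (𝔈 x)).Gp) (fun _ lam => ¬ (lam.isRight = true)))
    (hH2 : AtOneH2On geo9Y (bg9Y 𝔸 G) (fun x => (operatorLayerYOfLetters 𝔸 G x (𝔏 x) (𝔈 x)).Gp) (fun _ lam => ¬ (lam.isRight = true))) :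
    ResidualGpAtOne geo9Y (bg9Y 𝔸 G) (fun x => (operatorLayerYOfLetters 𝔸 G x (𝔏 x) (𝔈 x)).Gp) :=
  residualGpAtOne_letters_of_leaves5 𝔏 𝔈 (atOneL2nOn_Gp_letters_3 𝔏 𝔈) (atOneL2nOn_Gp_letters_4 𝔏 𝔈)
    (atOneL2nOn_Gp_letters_5 𝔏 𝔈) hE4 hH2

end Layer

/-! ## §4 At the record: `ops := opsYOfLetters N θ M⋆ 𝔏 𝔈` -/

section Record

open scoped Matrix.Norms.L2Operator

variable (N : ℕ) (θ : Stage3Params) (Mstar' : ℕ) (𝔏 : LettersY N θ Mstar') (𝔈 : ExpsY N θ Mstar')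

/-- ★★ the (3.46) member-leaf `‖h∇_UG′∇*_Uλ‖` at the record's layer of letters. [cite: Balaban1985BackgroundPropagators, Thm 3.1 (3.46) p.398 + Cor. 3.5 p.407] -/
theorem atOneL2nOn_Gp_opsYOfLetters_3 :
    AtOneL2nOn geo9Y (bg9Y (Matrix (Fin N) (Fin N) ℂ) (specialUnitaryUnits (Fin N))) (fun x => (opsYOfLetters N θ Mstar' 𝔏 𝔈 x).Gp)
      (fun _ lam => ¬ (lam.isRight = true)) 3 :=
  atOneL2nOn_Gp_letters_3 𝔏 𝔈

/-- ★★ the (3.46) member-leaf `‖h∇_U∇_UG′λ‖` at the record's layer of letters. [cite: Balaban1985BackgroundPropagators, Thm 3.1 (3.46) p.398 + Cor. 3.5 p.407] -/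
theorem atOneL2nOn_Gp_opsYOfLetters_4 :
    AtOneL2nOn geo9Y (bg9Y (Matrix (Fin N) (Fin N) ℂ) (specialUnitaryUnits (Fin N))) (fun x => (opsYOfLetters N θ Mstar' 𝔏 𝔈 x).Gp)
      (fun _ lam => ¬ (lam.isRight = true)) 4 :=
  atOneL2nOn_Gp_letters_4 𝔏 𝔈

/-- ★★ the (3.46) member-leaf `‖hG′∇*_U∇*_Uλ‖` at the record's layer of letters. [cite: Balaban1985BackgroundPropagators, Thm 3.1 (3.46) p.398 + Cor. 3.5 p.407] -/
theorem atOneL2nOn_Gp_opsYOfLetters_5 :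
    AtOneL2nOn geo9Y (bg9Y (Matrix (Fin N) (Fin N) ℂ) (specialUnitaryUnits (Fin N))) (fun x => (opsYOfLetters N θ Mstar' 𝔏 𝔈 x).Gp)
      (fun _ lam => ¬ (lam.isRight = true)) 5 :=
  atOneL2nOn_Gp_letters_5 𝔏 𝔈

/-- ★★ **THE KNIT BINDER `hGp` AT NODE 00's OPERATOR LAYER OF LETTERS FROM (3.44) + (3.45) ONLY** — conclusion LITERALLY the binder `hGp` of
`Summit.…b9_main_of_up_view₁₁B10YZW_of_obligations` at `ops := opsYOfLetters N θ M⋆ 𝔏 𝔈`; hypotheses = the two input-Hölder leaves (3.44), (3.45) of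
G′(1) on site arguments; the six (3.46) members, (3.47) and (3.43) (as typed) are PROVED.
[cite: Balaban1985BackgroundPropagators, Cor. 3.5 p.407 + Thm 3.1 (3.43)–(3.47) p.398; Balaban1984PropagatorsII, Prop. 2.2 (2.67), Lemma 2.1 p.234] -/
theorem hGp_opsYOfLetters_of_leaves2
    (hE4 : AtOneE4On geo9Y (bg9Y (Matrix (Fin N) (Fin N) ℂ) (specialUnitaryUnits (Fin N))) (fun x => (opsYOfLetters N θ Mstar' 𝔏 𝔈 x).Gp)
      (fun _ lam => ¬ (lam.isRight = true)))
    (hH2 : AtOneH2On geo9Y (bg9Y (Matrix (Fin N) (Fin N) ℂ) (specialUnitaryUnits (Fin N))) (fun x => (opsYOfLetters N θ Mstar' 𝔏 𝔈 x).Gp)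
      (fun _ lam => ¬ (lam.isRight = true))) :
    B9FromB6.ResidualGpAtOne geo9Y (bg9Y (Matrix (Fin N) (Fin N) ℂ) (specialUnitaryUnits (Fin N))) (fun x => (opsYOfLetters N θ Mstar' 𝔏 𝔈 x).Gp) :=
  residualGpAtOne_letters_of_leaves2 𝔏 𝔈 hE4 hH2

end Record

end Literature.MathematicalPhysics.QuantumFieldTheory.Balaban1983to89.B9Ineq346SecondOrderGpAtLetters

end
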